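import Summits.BirchSwinnertonDyer.Rank1Residual.GaloisImage.KuriharaRecordBSDpThreeLevelOneEnd
import Summits.BirchSwinnertonDyer.Rank1Residual.GaloisImage.LocalThreeTorsionDecider
import Summits.BirchSwinnertonDyer.Rank1Residual.Additive.X4ThreeKuriharaCertRecordsS2_30
import HarnessLib

/-!
# N11 LOWER@3: END-m1 RECORDS ([K25]-FREE `BSD(E,3)` record shapes from ONE level-one Kurihara unit
# and two level-zero fields) — series file 18: `19809d1`
# (cell `b2b-bsdres`, team n1011, seat p03, OWNERS row T-R1-57-REC = the SERIES behind n1011-p18's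
# pilot `Additive/X4ThreeKuriharaEndM1Record2718d1.lean`; END theorems = n1011-p18's
# `GaloisImage/KuriharaRecordBSDpThreeLevelOneEnd.lean` (p290368), LOWER input = n1011-p09's END-m1
# `GaloisImage/KolyvaginLevelOneNineDivides[OfS24].lean` (p289201 / p289712); r1 ROUTE-1 §33.3 / §33.8)

HONEST FRAMING (cell `b2b-bsdres`, run/shared/lean/b2b/bsd-rank1-residual/, verbatim in every
file): the goal of the cell is to DELETE the COMBINATION-SHAPED residual classes of the
Birch–Swinnerton-Dyer formula for ALL analytic-rank `≤ 1` elliptic curves over `ℚ` — "full BSD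
formula for every rank `≤ 1` curve in class `C`" assembled STRICTLY from published theorems — so
that the rank-`≤ 1` remainder becomes exactly the CONSTRUCTION-SHAPED classes, which are TYPED
(missing-input `Prop`s), NOT attempted. This is not "finishing BSD". Team n1011 (N10/N11, the
additive block `X4 ∧ p = 3`) is a RESEARCH ROUTE; no claim beyond the stated classes; the label X4 and
the mark of RESIDUAL-MAP §I N11 (LOWER@3) are UNCHANGED. **These records CLOSE NOTHING and move no
mark**: PER-PAIR record SHAPES, not a class theorem; EVIDENCE-grade booking CANDIDATES for the director,
nothing is booked by this file. END-m1 is DEBT REDUCTION, not coverage: `BSD(E,3)` only where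
`ord₃(L(E,1)/Ω_E) ≤ 2`, CONDITIONAL on the UPPER-half facts of the X4 chain of record (`hKatoS hDel
hmodD hKatoχ`; `hGZK hmod h26`), Cassels–Tate (`hCT`), the Poitou–Tate family at `3` (`inv hperf hsum
hunro hcompl`), Tate's `hEP`, the ONE port `KatoKuriharaPortThreeAt W 0 v₃` (FLAG `K22-Thm3.13-PORT@3`),
and — in THIS interim form — ONE [S24] NAMED FACT `hS24` (Sakamoto JTNB 36 (2024) Thm. 4.4 (1), used
only through n1011-p09's level-one injectivity; n1011-p11's G5 `CoreRankOne.apply_eq_zero_of_apply_core_eq_zero`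
(p290776, LANDED) replaces it by a one-binder swap when the G5-form END is filed, after which END-m1
carries NO [S24] fact).  The three Kurihara VALUES in `hδ` are HYPOTHESES labelled EVIDENCE (two sources
each, named per record); the words of the census register are quoted only where the register has them.
Theorems only (no definition, no named fact minted).

## What this file does

For each row `E` below — Cremona's minimal model; `N = 3²·M`, ADDITIVE at `3`; class A1 (surj(3),
`E(ℚ₃)[3] = 0`), `r_an = 0`, UNIT (`3 ∤ ∏ c_ℓ`), `ord₃ #Ш_an = 2`; one of the 36 rows of r1 §33.8's join
`cells/n1011/route1/g21_endm1_candidates.tsv`, EACH of which carries p03's landed engine-2 × second-engine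
[K25]-conditional record `bsdp3_kur_v<label>` AT THE SAME `(row, n)` — the record `bsdp3_endm1_v<label>`
(`integralModelInt` currency) and its LITERAL-model twin `…_of_eq` : `BSDp W 3` by n1011-p18's END
`Assembly.bsdp_three_potMult_of_levelOneCertificates_of_S24` on the potentially MULTIPLICATIVE rows
(`ord₃ j < 0` read off the model, `3 ∤ c₃` from the kernel numeral `∏ c_ℓ`, surj(3); NO tower / Manin on
the UPPER side) or `Assembly.bsdp_three_of_towerSurj_of_levelOneCertificates_of_S24` on the potentially
GOOD rows (tower `towerSurj3_v<label>` and `3 ∤ ∏ c_ℓ` kernel-side), fed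
* BY NAME from the landed S2 / GaloisImage records of the same row: `surj3_v<label>` /
  `towerSurj3_v<label>`, `tamagawaProduct_v<label>` (observatory Tate-algorithm certificates), the point
  counts `card_v<label>_<ℓ>`; `Addv W 3` (`3 ∣ Δ`, `3 ∣ c₄`) by `decide` on Cremona's coefficients;
* with NEW kernel numerics per row (CERTIFICATES): `natCard_threeTorsion_v<label>` — `#E(ℚ₃)[3] = 1` by
  n1011-p17's decider `LocalTorsion3.threeTorsionCheck` (`decide +kernel`; certificate `(k, cert)` found
  OUTSIDE the kernel by n1011-p17's `census/loc3t_cert2.py`, run unchanged); `isKolyvaginProduct_one_v<label>`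
  — `n = ℓ_a ℓ_b ∈ 𝒩₁(E,3)` from the two point counts; `forall_card_torsion_le_v<label>` — cyclicity
  `#Ẽ(𝔽_ℓ)[3] ≤ 3` at both level primes (count when `9 ∤ #Ẽ`, ONE root of `Ψ₃ mod ℓ` when `9 ∣ #Ẽ`);
* with EVIDENCE BINDERS per pair: `r_an = 0` (`hr`, Cremona), the OPTIMAL datum at level `N` (`D`,
  `hopt`; Cremona; `3 ∤ c_D` by Agashe–Ribet–Stein Thm. 2.6, `N ≤ 130000`), and `hδ` = THREE VALUES,
  each a HYPOTHESIS with TWO SOURCES (lead R5-68 (i) / R5-67 (d)): (1) `δ̃_n(ψ) ≢ 0 (mod 3)` at the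
  named level — n1011-p08's engine 2 (E2-AT3 STAGE 2, kit j128824) × cc-eng-3's ENG-D KFOLD fold of
  its S0-D3 two-engine symbol tables (or cc-eng-6 KURX where the S2 record says so), blind AGREE, as
  recorded in p03's `X4ThreeKuriharaCertRecordsS2_*` docstrings / `KURIHARA-RECORDS-INDEX.tsv`
  (census-lead GEN 11's register word for those S2 records: 'two-implementation UNIT certificate at
  (row, n)'); (2) `δ̃_1 ≡ 0 (mod 3)` and (3) `δ̃_1 ≢ 0 (mod 27)`, i.e. `ord₃ [0]⁺ = 2` — source A:
  Cremona's `allbsd` via the E2-AT3 register `curves_stage2v2.tsv` (`#Ш_an = 9`, `∏ c_ℓ`, `#T` ⟹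
  `ord₃ (L(E,1)/Ω_E) = 2`); source B: engine 2 j128824's exact modular-symbol fields `L_over_OmegaE`,
  `v = 2` (`[0]⁺` and `L(E,1)/Ω_E` differ by `c_D = ±1` and `c_∞ ∈ {1, 2}`, units at `3`). No
  register word exists for the level-zero values; none is claimed.
Nothing is booked; class X4 stays CONSTRUCTION-SHAPED; N11's mark is unchanged.

References: C.-H. Kim, AJM 148 (2026) Thm. 1.9 (6), Thm. 3.13, §1.2.2 [Kim2022StructureSelmer];
R. Sakamoto, JTNB 36 (2024) Thm. 4.4 (1) [Sakamoto2024]; K. Kato, Astérisque 295 (2004) Thm. 14.5 (3)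
[Kato2004Asterisque]; D. Delbourgo (1998) Prop. 4 [Delbourgo1998]; Agashe–Ribet–Stein (2006) Thm. 2.6
[AgasheRibetStein2006]; J. H. Silverman, AEC (2009) VII.1, VII.5, X.4.14 [SilvermanAEC2009]; A. Kraus (1989)
Prop. 2 [Kraus1989]; J.-P. Serre (1972) §2.4 Prop. 15 [Serre1972]; R. L. Miller, LMS JCM 14 (2011) Def. 1.1
[Miller2011LMS]; Cremona's tables [Cremona2006]; cell files cells/n1011/ROUTE-1.md §33.3/§33.8,
`route1/g21_endm1_candidates.tsv`, OWNERS.md (T-R1-57-B, T-R1-57-REC), `b2b-bsdres-n1011-p03/KURIHARA-RECORDS-INDEX.tsv`.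
-/

set_option autoImplicit false

noncomputable section

open scoped Classical NumberField

open Function NumberField IsDedekindDomain WeierstrassCurve
  Literature.NumberTheory.EllipticCurves Literature.NumberTheory.EllipticCurves.ModularForms
  Literature.NumberTheory.EllipticCurves.Rank1Residual
  Literature.NumberTheory.EllipticCurves.AgasheRibetStein2006
  Literature.NumberTheory.EllipticCurves.Rank1Residual.X11RankOneCertificates
  Literature.NumberTheory.GaloisRepresentations
  Literature.NumberTheory.GaloisRepresentations.DiscreteGaloisModule Literature.NumberTheory.GaloisCohomology
  IsDedekindDomain.HeightOneSpectrum Rat.HeightOneSpectrum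
  Summit.BirchSwinnertonDyer.BirchSwinnertonDyer.Rank1Residual.IntModel
  Summit.BirchSwinnertonDyer.BirchSwinnertonDyer.Rank1Residual.X11RankOne
  Summit.BirchSwinnertonDyer.Rank1Residual.GaloisImage Summit.BirchSwinnertonDyer.Rank1Residual.X4

namespace Summit.BirchSwinnertonDyer.Rank1Residual.Additive.X4ThreeKuriharaCert

/-! ### END-m1 record: `19809d1` (`N = 19809`, potentially GOOD at `3` (G-ss); `∏ c_ℓ = 2`, `#T = 1`, `#Ш_an = 9`), level `n = 37·61 = 2257` -/

/-- **`#E(ℚ₃)[3] = 1` for `19809d1` IN THE KERNEL** (class A1's `t = 0`; any globally minimal elliptic `W` with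
Cremona's integral model `[0, 0, 1, -393, -2999]`): n1011-p17's decider `LocalTorsion3.threeTorsionCheck` run by
`decide +kernel` on the certificate `k = 2`, `cert = [[24, 1, 3, 0]]` (Hensel balls `(c, m, N, w)`; found
outside the kernel by n1011-p17's `census/loc3t_cert2.py`, unchanged; engine 2 j128824's `t_loc = 0` agrees).
A kernel CERTIFICATE, not evidence. [cite: SilvermanAEC2009, VII.1 Remark 1.1 and VII.3 Prop. 3.1] -/
theorem natCard_threeTorsion_v19809d1 (W : WeierstrassCurve ℚ) [W.IsElliptic] [W.IsGloballyMinimal]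
    (hI : integralModelInt W = ⟨0, 0, 1, -393, -2999⟩) :
    Nat.card {Q : (W.baseChange ℚ_[3]).toAffine.Point // (3 : ℕ) • Q = 0} = 1 :=
  (LocalTorsion3.natCard_threeTorsion_eq_three_pow_zero_of_intModel_of_check 0 0 1 (-393) (-2999) W hI
    (k := 2) (cert := [((24 : ℤ), 1, 3, 0)]) (by decide +kernel)).trans (pow_zero 3)

/-- **`2257 = 37·61 ∈ 𝒩₁(19809d1, 3)` IN THE KERNEL** (both primes good, `≠ 3`, `≡ 1 (mod 3)`, `3 ∣ #Ẽ(𝔽_ℓ)`: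
counts `36`, `57` — the landed `card_v19809d1_37`, `card_v19809d1_61` reused by name).
[cite: Kim2022StructureSelmer, §1.2.2 (PDF p. 4)] -/
theorem isKolyvaginProduct_one_v19809d1 {W : WeierstrassCurve ℚ} [W.IsElliptic] [W.IsGloballyMinimal]
    (hI : integralModelInt W = ⟨0, 0, 1, -393, -2999⟩) :
    haveI : Fact (Nat.Prime 3) := ⟨Nat.prime_three⟩
    Kato.IsKolyvaginProduct W 3 1 2257 := by
  haveI : Fact (Nat.Prime 3) := ⟨Nat.prime_three⟩
  haveI : Fact (Nat.Prime 37) := ⟨by norm_num⟩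
  haveI : Fact (Nat.Prime 61) := ⟨by norm_num⟩
  have h37 : Kato.IsKolyvaginPrime W 3 1 37 :=
    isKolyvaginPrime_of_intModel_of_card hI 3 1 37 (by norm_num) (by decide +kernel) (by decide)
      card_v19809d1_37 (by decide)
  have h61 : Kato.IsKolyvaginPrime W 3 1 61 :=
    isKolyvaginPrime_of_intModel_of_card hI 3 1 61 (by norm_num) (by decide +kernel) (by decide)
      card_v19809d1_61 (by decide)
  exact_mod_cast isKolyvaginProduct_mul h37 h61 (by norm_num)

/-- **Cyclicity `#Ẽ(𝔽_ℓ)[3] ≤ 3` at both primes of `2257 = 37·61` for `19809d1` IN THE KERNEL** (`37`: `9 ∣ 36`: the single `Ψ₃`-root `3 mod 37`; `61`: `9 ∤ 57` (count)).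
[cite: SilvermanAEC2009, III.6.4 (b) and VII.3 Prop. 3.1] -/
theorem forall_card_torsion_le_v19809d1 {W : WeierstrassCurve ℚ} [W.IsGloballyMinimal]
    (hI : integralModelInt W = ⟨0, 0, 1, -393, -2999⟩) :
    ∀ (ℓ : ℕ) [Fact ℓ.Prime], ℓ ∣ 2257 →
      Nat.card {P : ((WeierstrassCurve.integralModelInt W).map
          (Int.castRingHom (ZMod ℓ))).toAffine.Point // 3 • P = 0} ≤ 3 := by
  haveI : Fact (Nat.Prime 37) := ⟨by norm_num⟩
  haveI : Fact (Nat.Prime 61) := ⟨by norm_num⟩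
  have c37 := card_three_torsion_le_of_intModel_of_psi3_root hI 37 3 (by decide +kernel)
  have c61 := card_torsion_le_of_intModel_of_card hI 3 61 card_v19809d1_61 (by decide)
  intro ℓ hℓ hdvd
  exact forall_card_torsion_le_of_dvd_mul 3 37 61 c37 c61 ℓ (by norm_num at hdvd ⊢; exact hdvd)

/-- **END-m1 RECORD `19809d1` at the level `n = 37·61 = 2257 ∈ 𝒩₁(E,3)` — [K25]-FREE, interim `hS24` form; CLOSES
NOTHING, moves no mark** (`integralModelInt` currency: any globally minimal elliptic `W` with Cremona's integral model
`[0, 0, 1, -393, -2999]`; `N = 19809`; ADDITIVE at `3` by `decide`; UPPER side (potentially GOOD, G-ss): the `3`-adic tower (`towerSurj3_v19809d1`) and `3 ∤ ∏ c_ℓ = 2` (`tamagawaProduct_v19809d1`) kernel-side, optimal datum at `N ≤ 130000`; `#E(ℚ₃)[3] = 1`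
(`natCard_threeTorsion_v19809d1`, kernel certificate); the level `2257 ∈ 𝒩₁` and cyclicity at `37, 61` IN THE KERNEL
(`isKolyvaginProduct_one_v19809d1`, `forall_card_torsion_le_v19809d1`)) ⟹ `BSD(E,3)` by n1011-p18's
`Assembly.bsdp_three_of_towerSurj_of_levelOneCertificates_of_S24`. HYPOTHESES: the UPPER facts `hKatoS hDel hmodD hKatoχ`,
`hGZK hmod h26`; `hS24` = INTERIM NAMED FACT ([S24] Thm. 4.4 (1), level-one injectivity only; G5 swap pending); `hCT`;
the Poitou–Tate family `inv hperf hsum hunro hcompl`, Tate's `hEP`, the port `hPort` (FLAG `K22-Thm3.13-PORT@3`);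
EVIDENCE binders `hr` (`r_an = 0`, Cremona), the OPTIMAL datum `D`/`hopt` at level `19809` (Cremona), and `hδ` = THREE VALUES,
each EVIDENCE with two sources: (1) `δ̃_{2257}(ψ) ≢ 0 (mod 3)` — engine 2 = E2-AT3 STAGE 2 j128824 (residue 2 mod 3) × second source = ENG-D KFOLD-S0D3 9ba005ba24e0b029 (tables j129014/j130123) (residue 1 mod 3), blind AGREE — as in the landed S2 record `bsdp3_kur_v19809d1` (Additive/X4ThreeKuriharaCertRecordsS2_30.lean, p275102); census-lead GEN 11 register word for that record: 'two-implementation UNIT certificate at (row, n)'; (2) `δ̃_1 ≡ 0 (mod 3)` and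
(3) `δ̃_1 ≢ 0 (mod 27)` (`ord₃ [0]⁺ = 2`) — source A = Cremona `allbsd` via the E2-AT3 register (`#Ш_an = 9`, `∏ c_ℓ = 2`, `#T = 1` ⟹ `ord₃ (L(E,1)/Ω_E) = ord₃ (9·2/1²) = 2`); source B = engine 2 j128824 exact modular-symbol fields `L_over_OmegaE = 18`, `v = 2` (and `t_loc = 0`); no register word exists for the level-zero values, none claimed. DEBT REDUCTION, not coverage; nothing booked.
[cite: Kim2022StructureSelmer, Thm. 1.9 (6), Thm. 3.13 and §1.2.2] [cite: Sakamoto2024, Thm. 4.4 (1) (p. 926)]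
[cite: Kato2004Asterisque, Thm. 14.5 (3) (p. 236)] [cite: Delbourgo1998, Prop. 4 (p. 144)]
[cite: AgasheRibetStein2006, Thm. 2.6 (p. 619)] [cite: SilvermanAEC2009, VII.5 Prop. 5.1 (c) and Thm. X.4.14]
[cite: Miller2011LMS, §1 and Def. 1.1] -/
theorem bsdp3_endm1_v19809d1
    -- UPPER half: the X4 chain of record; GZK; modularity; ARS 2.6
    (hKatoS : Kato2004.rankZero_padicValNat_sha_le_sub_localTamagawa_of_additive_potGood_of_imageContainsSL2)
    (hDel : Delbourgo1998.prop4_rankZero_pow_dvd_constantCoeff)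
    (hGZK : rank_eq_analyticRank_of_analyticRank_le_one) (hmod : hasEntireLFunction_rat)
    (hmodD : nonempty_modularParametrizationData)
    (hKatoχ : Wuthrich2014.kato_halfEigenCharIdeal_dvd_cyclotomicPrime_of_surjective)
    (h26 : cremona_abs_maninConstant_eq_one_of_level_le)
    -- LOWER half: [S24] Thm. 4.4 (1) — INTERIM (level-one injectivity only; G5 swap pending); Cassels–Tate
    (hS24 : Sakamoto2024.kolyvaginSystems_freeRankOne_zmod_three_pow)
    (hCT : exists_casselsTate_pairing (K := ℚ))
    -- the row
    {W : WeierstrassCurve ℚ} [W.IsElliptic] [W.IsGloballyMinimal]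
    (hI : integralModelInt W = ⟨0, 0, 1, -393, -2999⟩)
    (hr : W.analyticRank = 0)
    (D : ModularParametrizationData W 19809)
    (hopt : ∀ z ∈ D.L.lattice, ∃ w ∈ periodLattice D.f, z = D.c * w)
    -- LOWER half: the Poitou–Tate family at `3`, Tate's local Euler characteristic, the ONE port
    (inv : LocalInvariants ℚ 3) (hperf : inv.IsPerfect) (hsum : inv.SumLocalTermEqZero)
    (hunro : inv.UnramifiedOrthogonal) (hcompl : inv.SelmerComplement)
    (hEP : ∀ v : HeightOneSpectrum (𝓞 ℚ), localEulerPoincareCharacteristic (v.adicCompletion ℚ))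
    (v₃ : HeightOneSpectrum (𝓞 ℚ)) (hv₃ : ((3 : ℕ) : 𝓞 ℚ) ∈ v₃.asIdeal)
    (hPort : KatoKuriharaPortThreeAt W 0 v₃)
    -- the CERTIFICATE: THREE VALUES (EVIDENCE, two sources each — see the docstring)
    (hδ : ∃ (ψ : (ℓ : ℕ) → (ZMod ℓ)ˣ →* Multiplicative (ZMod (3 ^ 1)))
        (ψ₂₇ : (ℓ : ℕ) → (ZMod ℓ)ˣ →* Multiplicative (ZMod (3 ^ 3))),
      (∀ ℓ ∈ (2257 : ℕ).primeFactors, Function.Surjective (ψ ℓ)) ∧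
        kuriharaNumber D.f (3 ^ 1) 2257 ψ ≠ 0 ∧ kuriharaNumber D.f (3 ^ 1) 1 ψ = 0 ∧
        kuriharaNumber D.f (3 ^ 3) 1 ψ₂₇ ≠ 0) :
    BSDp W 3 := by
  haveI : Fact (Nat.Prime 3) := ⟨Nat.prime_three⟩
  haveI : NeZero (2257 : ℕ) := ⟨by norm_num⟩
  obtain ⟨ψ, ψ₂₇, hψ, hcert, hzero₁, hunit₁⟩ := hδ
  exact Assembly.bsdp_three_of_towerSurj_of_levelOneCertificates_of_S24 hKatoS hDel hGZK hmod hmodD hKatoχ h26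
    hS24 hCT W hI (by decide +kernel) (by decide +kernel) (towerSurj3_v19809d1 hI)
    (natCard_threeTorsion_v19809d1 W hI) hr (by rw [tamagawaProduct_v19809d1 hI]; decide) (by norm_num) D hopt
    inv hperf hsum hunro hcompl hEP v₃ hv₃ hPort
    2257 (isKolyvaginProduct_one_v19809d1 hI) (forall_card_torsion_le_v19809d1 hI) ψ hψ hcert hzero₁ ψ₂₇ hunit₁

/-- **END-m1 RECORD `19809d1` on the LITERAL model `W = [0, 0, 1, -393, -2999]`** (pilot pattern: `hI` from `hW` by
`integralModelInt_eq_of_map_eq`; then `bsdp3_endm1_v19809d1`). Same HYPOTHESES / EVIDENCE binders / framing as `bsdp3_endm1_v19809d1`: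
[K25]-FREE, interim `hS24`, THREE values in `hδ` each EVIDENCE with two sources; CLOSES NOTHING, moves no mark; nothing booked.
[cite: Kim2022StructureSelmer, Thm. 1.9 (6) and Thm. 3.13] [cite: Sakamoto2024, Thm. 4.4 (1) (p. 926)]
[cite: SilvermanAEC2009, VII.1 Remark 1.1] -/
theorem bsdp3_endm1_v19809d1_of_eq
    -- UPPER half: the X4 chain of record; GZK; modularity; ARS 2.6
    (hKatoS : Kato2004.rankZero_padicValNat_sha_le_sub_localTamagawa_of_additive_potGood_of_imageContainsSL2)
    (hDel : Delbourgo1998.prop4_rankZero_pow_dvd_constantCoeff)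
    (hGZK : rank_eq_analyticRank_of_analyticRank_le_one) (hmod : hasEntireLFunction_rat)
    (hmodD : nonempty_modularParametrizationData)
    (hKatoχ : Wuthrich2014.kato_halfEigenCharIdeal_dvd_cyclotomicPrime_of_surjective)
    (h26 : cremona_abs_maninConstant_eq_one_of_level_le)
    -- LOWER half: [S24] Thm. 4.4 (1) — INTERIM (level-one injectivity only; G5 swap pending); Cassels–Tate
    (hS24 : Sakamoto2024.kolyvaginSystems_freeRankOne_zmod_three_pow)
    (hCT : exists_casselsTate_pairing (K := ℚ))
    -- the row (LITERAL model)
    (W : WeierstrassCurve ℚ) [W.IsElliptic] [W.IsGloballyMinimal]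
    (hW : W = ⟨0, 0, 1, -393, -2999⟩)
    (hr : W.analyticRank = 0)
    (D : ModularParametrizationData W 19809)
    (hopt : ∀ z ∈ D.L.lattice, ∃ w ∈ periodLattice D.f, z = D.c * w)
    -- LOWER half: the Poitou–Tate family at `3`, Tate's local Euler characteristic, the ONE port
    (inv : LocalInvariants ℚ 3) (hperf : inv.IsPerfect) (hsum : inv.SumLocalTermEqZero)
    (hunro : inv.UnramifiedOrthogonal) (hcompl : inv.SelmerComplement)
    (hEP : ∀ v : HeightOneSpectrum (𝓞 ℚ), localEulerPoincareCharacteristic (v.adicCompletion ℚ))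
    (v₃ : HeightOneSpectrum (𝓞 ℚ)) (hv₃ : ((3 : ℕ) : 𝓞 ℚ) ∈ v₃.asIdeal)
    (hPort : KatoKuriharaPortThreeAt W 0 v₃)
    -- the CERTIFICATE: THREE VALUES (EVIDENCE, two sources each — see the docstring)
    (hδ : ∃ (ψ : (ℓ : ℕ) → (ZMod ℓ)ˣ →* Multiplicative (ZMod (3 ^ 1)))
        (ψ₂₇ : (ℓ : ℕ) → (ZMod ℓ)ˣ →* Multiplicative (ZMod (3 ^ 3))),
      (∀ ℓ ∈ (2257 : ℕ).primeFactors, Function.Surjective (ψ ℓ)) ∧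
        kuriharaNumber D.f (3 ^ 1) 2257 ψ ≠ 0 ∧ kuriharaNumber D.f (3 ^ 1) 1 ψ = 0 ∧
        kuriharaNumber D.f (3 ^ 3) 1 ψ₂₇ ≠ 0) :
    BSDp W 3 := by
  have hI : integralModelInt W = ⟨0, 0, 1, -393, -2999⟩ := by
    subst hW
    exact integralModelInt_eq_of_map_eq _ (map_mk_int 0 0 1 (-393) (-2999))
  exact bsdp3_endm1_v19809d1 hKatoS hDel hGZK hmod hmodD hKatoχ h26 hS24 hCT hI hr D hopt inv hperf hsum hunro
    hcompl hEP v₃ hv₃ hPort hδ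

end Summit.BirchSwinnertonDyer.Rank1Residual.Additive.X4ThreeKuriharaCert

end
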